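import Summits.QuantumFields.YangMills.Theorems.BalabanUVNodesN07CritTangentAtRecord
import Literature.MathematicalPhysics.QuantumFieldTheory.Balaban1983to89.B12SemisimpleNormalTori
import Literature.MathematicalPhysics.QuantumFieldTheory.Balaban1983to89.LogChartClosedSubgroup

/-!
# BalabanUVNodes ∕ N07 — TANGENT-CRITICAL ⇒ CURVE-CRITICAL AT THE ONE-SCALE PIN, AND THE EQUIVALENCE (module 35e of GAP-STATED(submersion)):
# at small fields the CURVE form of «critical configuration of (5) on 𝔅_k(V)» IS print's TANGENT form (82)

Cell `pub-ymgap`, seat `pub-ymgap-dag-n07-e` generation 14 (R141 (C), DAG node N07 = [15]; MODULE 35e; INBOX INTENT-35e).  `--kind proof --supports stmt-QuantumFields-20541`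
(count-neutral).  CONSUMED BY NAME: this seat's 35b-i `Node00.AveragingSmooth` (`iterM`, `contDiffAt_iterM`, `coeField_iter_eq_iterM`), 35c `N07CritTangentAtRecord`
(`tendsto_coeField_iter_of_tendsto`, `eventually_plaqSmall_iter_of_tendsto`, ★★★ `hasDerivAt_wilsonAction4_expChart_of_isCritOfRecord_of_small`), 35a
`Node00.CriticalOnFibreTangent` (`expChart`, `hasDerivAt_wilsonAction4_of_sameVelocity`), g8 `Node00.WilsonActionFirstVariation` (`star_deriv_mul_add_eq_zero`), and the
tree's `MatrixLie.mem_lieSet_of_hasDerivAt` (velocities of curves in a closed unitary group), `B12SemisimpleNormalTori.isClosedUnitaryGroup_specialUnitaryGroup`,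
`LogChartClosedSubgroup.mem_su_iff_forall_exp_mem_specialUnitaryGroup` ([Hall2015] Prop. 3.24 at `SU(N)`).

WHY.  35c proved CURVE-critical ⇒ TANGENT-critical at the one-scale pin of record for configurations with small iterated averages.  This file proves the CONVERSE
— every velocity of a fibre curve through `U` is `U·X` for a Lie-algebra field `X` (§1: the velocity of an `SU(N)`-valued curve at `g` is `g·X`, `X ∈ 𝔰𝔲(N)`,
by the closed-subgroup velocity lemma and Hall's Prop. 3.24), and such an `X` is a kernel direction of the linearised `k`-fold averaging (§2: the Fréchet
derivative of 35b-i's `C^∞` matrix extension `iterM k` at `↑U` kills `U·X` because `Ū^k` is constant along the fibre curve, and the ray `U·exp(tX)` has the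
same velocity) —, so that at small fields the two readings of [15]'s «critical configuration of (5) on 𝔅_k(V)» COINCIDE (§3, `isCritOfRecord_iff_tangentCritical`):
the tree's curve-form pin `IsCritOfRecord` (g2) IS print's (82) on (83).  The reading GAP-STATED(submersion) of the N07 tokens is thereby not merely
discharged in the direction print uses but shown to be an equivalent formulation at the one-scale pin.

HONEST FRAMING: count-neutral; calculus about the tree's own objects; nothing of [15]'s estimates; multi-scale `genSet` NOT treated; V16 stub 1 ∕ K0⁷ NOT closed; N07 NOT
discharged (5∕27); one finite T⁴ programme at fixed ε — NOT continuum ∕ ℝ⁴ ∕ OS ∕ mass gap ∕ Clay.  No `sorry`, no `def`.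
-/

noncomputable section

open scoped Matrix.Norms.L2Operator Topology
open Filter Asymptotics Function NormedSpace

namespace Summit.QuantumFields.YangMills.BalabanUVNodes.N07CritTangentConverse

open Literature.MathematicalPhysics.QuantumFieldTheory.Balaban1983to89
open Literature.MathematicalPhysics.QuantumFieldTheory.Balaban1983to89.T4Continuum (T4Family)
open Literature.MathematicalPhysics.QuantumFieldTheory.Balaban1983to89.B15DeterminingSets
open Literature.MathematicalPhysics.QuantumFieldTheory.Balaban1983to89.BlockAveraging
open Literature.MathematicalPhysics.QuantumFieldTheory.Balaban1983to89.BlockAveragingEMLHaarAC (emlWeight)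
open Literature.MathematicalPhysics.QuantumFieldTheory.Balaban1983to89.ExpMeanLog (expMeanLogSU deltaSU deltaSU_pos)
open Literature.MathematicalPhysics.QuantumFieldTheory.Balaban1983to89.T4AdjointCovarianceUnitary (lieSU mem_lieSU_iff)
open Literature.MathematicalPhysics.QuantumFieldTheory.Balaban1983to89.Node00
open Literature.RepresentationTheory.CompactGroups (MatrixLie.mem_lieSet_of_hasDerivAt MatrixLie.mem_lieSet)
open Summit.QuantumFields.YangMills.Theorems.BlockAvgCorrector (stokesConst stokesConst_nonneg)
open Summit.QuantumFields.YangMills.BalabanUVNodes.N07CritTangentAtRecord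

/-! ## §1  Velocities of `SU(N)`-valued curves are `g·X`, `X ∈ 𝔰𝔲(N)` -/

section Velocity

variable {N : ℕ} [NeZero N]

/-- ★ **THE VELOCITY OF AN `SU(N)`-VALUED CURVE AT `g = γ(0)` IS `g·X` WITH `X ∈ 𝔰𝔲(N)`**: `X := g⋆·γ′(0)` generates a one-parameter group inside `SU(N)` (the tree's
closed-subgroup velocity lemma `MatrixLie.mem_lieSet_of_hasDerivAt` for the curve `t ↦ g⋆·γ(t)` through `1`), hence is traceless skew-Hermitian ([Hall2015] Prop. 3.24,
`LogChartClosedSubgroup.mem_su_iff_forall_exp_mem_specialUnitaryGroup`). [cite: Balaban1985Variational, (4) p.278 (the group; bookkeeping); Balaban1987RG1, §0 p.252] -/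
theorem star_mul_deriv_mem_lieSU {γ : ℝ → SU N} {Y : Matrix (Fin N) (Fin N) ℂ}
    (hγ : HasDerivAt (fun t => ((γ t : SU N) : Matrix (Fin N) (Fin N) ℂ)) Y 0) :
    star ((γ 0 : SU N) : Matrix (Fin N) (Fin N) ℂ) * Y ∈ lieSU (Fin N) := by
  haveI : Nonempty (Fin N) := ⟨⟨0, Nat.pos_of_ne_zero (NeZero.ne N)⟩⟩
  set g : Matrix (Fin N) (Fin N) ℂ := ((γ 0 : SU N) : Matrix (Fin N) (Fin N) ℂ) with hg
  have hgU : g ∈ Matrix.unitaryGroup (Fin N) ℂ := Matrix.specialUnitaryGroup_le_unitaryGroup (γ 0).2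
  have hstar : star g * g = 1 := Unitary.star_mul_self_of_mem hgU
  -- the curve `δ t = g⋆·γ(t)` lies in `SU(N)`, passes through `1`, and has velocity `g⋆·Y`
  have hδ : HasDerivAt (fun t => star g * ((γ t : SU N) : Matrix (Fin N) (Fin N) ℂ)) (star g * Y) 0 := hγ.const_mul (star g)
  have hδ0 : star g * ((γ 0 : SU N) : Matrix (Fin N) (Fin N) ℂ) = 1 := hstar
  have hδS : ∀ᶠ t in 𝓝 (0 : ℝ), star g * ((γ t : SU N) : Matrix (Fin N) (Fin N) ℂ) ∈
      (Matrix.specialUnitaryGroup (Fin N) ℂ : Set (Matrix (Fin N) (Fin N) ℂ)) :=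
    Filter.Eventually.of_forall fun t => by
      have hmem : (((γ 0)⁻¹ * γ t : SU N) : Matrix (Fin N) (Fin N) ℂ) ∈ Matrix.specialUnitaryGroup (Fin N) ℂ := ((γ 0)⁻¹ * γ t).2
      exact hmem
  have hlie := MatrixLie.mem_lieSet_of_hasDerivAt B12SemisimpleNormalTori.isClosedUnitaryGroup_specialUnitaryGroup hδS hδ0 hδ
  rw [MatrixLie.mem_lieSet] at hlie
  exact (mem_lieSU_iff).2 ((LogChartClosedSubgroup.mem_su_iff_forall_exp_mem_specialUnitaryGroup (n := Fin N)).2 hlie)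

omit [NeZero N] in
/-- The velocity read back through the Lie-algebra field: `g · (g⋆·Y) = Y` (`g` unitary). [cite: Balaban1985Variational, (4) p.278 (bookkeeping)] -/
theorem coe_mul_star_mul_eq (g : SU N) (Y : Matrix (Fin N) (Fin N) ℂ) :
    (g : Matrix (Fin N) (Fin N) ℂ) * (star (g : Matrix (Fin N) (Fin N) ℂ) * Y) = Y := by
  rw [← mul_assoc, Unitary.mul_star_self_of_mem (Matrix.specialUnitaryGroup_le_unitaryGroup g.2), one_mul]

end Velocity

/-! ## §2  TANGENT-critical ⇒ CURVE-critical at the one-scale pin -/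

section Converse

variable {P : Params} {N : ℕ} [NeZero N]

/-- **THE GUARD BELOW `k` FROM `t₀`-SMALLNESS** (35b-i's `SmallBelow` for the (0.4) family). [cite: Balaban1987RG1, (0.4) p.253 (bookkeeping)] -/
theorem smallBelow_of_plaqSmall {t₀ : ℝ} (ht₀ : 0 < t₀) (hstδ : stokesConst P * t₀ < deltaSU (Fin N)) {k : ℕ} {U : GaugeField P 0 (SU N)}
    (hsm : ∀ i, i < k → PlaqSmall t₀ (Averaging.iter (fun i => blockAvg (P := P) (j := i) (expMeanLogSU (n := Fin N))) i U)) :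
    SmallBelow (fun i => blockAvg (P := P) (j := i) (expMeanLogSU (n := Fin N))) k U :=
  fun j hj c => LatticeWordStokes.small_of_plaqSmall (expMeanLogSU (n := Fin N)) ht₀.le (hsm j hj)
    (show stokesConst P * t₀ < deltaSU (Fin N) from hstδ) c

/-- ★ **ALONG A FAMILY CONTINUOUS AT `0` IN MATRICES, THE `k`-FOLD AVERAGE IS EVENTUALLY THE `C^∞` MATRIX EXTENSION**: `↑(Ū^k(Γ t)) = iterM k ↑(Γ t)` for `t` near `0`.
[cite: Balaban1987RG1, (0.4) p.253, (0.21) p.256] -/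
theorem eventually_coeField_iter_eq_iterM {t₀ : ℝ} (ht₀ : 0 < t₀) (hstδ : stokesConst P * t₀ < deltaSU (Fin N))
    {Γ : ℝ → GaugeField P 0 (SU N)} (hΓ : Tendsto (fun t => coeField (Γ t)) (𝓝 0) (𝓝 (coeField (Γ 0)))) {k : ℕ}
    (hsm : ∀ i, i < k → PlaqSmall t₀ (Averaging.iter (fun i => blockAvg (P := P) (j := i) (expMeanLogSU (n := Fin N))) i (Γ 0))) :
    ∀ᶠ t in 𝓝 (0 : ℝ), coeField (Averaging.iter (fun i => blockAvg (P := P) (j := i) (expMeanLogSU (n := Fin N))) k (Γ t)) =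
      iterM k (coeField (Γ t)) :=
  (eventually_plaqSmall_iter_of_tendsto ht₀ hstδ hΓ hsm).mono fun _ ht => coeField_iter_eq_iterM k (smallBelow_of_plaqSmall ht₀ hstδ ht)

/-- ★ **THE DERIVATIVE OF `Ū^k` ALONG A BOND-WISE DIFFERENTIABLE FAMILY** through a configuration with `t₀`-small iterated averages: the Fréchet derivative of the
`C^∞` matrix extension `iterM k` at `↑(Γ 0)`, applied to the velocity field. [cite: Balaban1987RG1, (0.4) p.253 («analytic function»), (0.21) p.256] -/
theorem hasDerivAt_coeField_iter {t₀ : ℝ} (ht₀ : 0 < t₀) (hstδ : stokesConst P * t₀ < deltaSU (Fin N))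
    {Γ : ℝ → GaugeField P 0 (SU N)} {Y : PBond P 0 → Matrix (Fin N) (Fin N) ℂ} (hΓ : HasDerivAt (fun t => coeField (Γ t)) Y 0) {k : ℕ}
    (hsm : ∀ i, i < k → PlaqSmall t₀ (Averaging.iter (fun i => blockAvg (P := P) (j := i) (expMeanLogSU (n := Fin N))) i (Γ 0))) :
    HasDerivAt (fun t => coeField (Averaging.iter (fun i => blockAvg (P := P) (j := i) (expMeanLogSU (n := Fin N))) k (Γ t)))
      ((fderiv ℝ (iterM k : (PBond P 0 → Matrix (Fin N) (Fin N) ℂ) → PBond P k → Matrix (Fin N) (Fin N) ℂ) (coeField (Γ 0))) Y) 0 := by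
  have hD : HasFDerivAt (iterM k : (PBond P 0 → Matrix (Fin N) (Fin N) ℂ) → PBond P k → Matrix (Fin N) (Fin N) ℂ)
      (fderiv ℝ (iterM k : (PBond P 0 → Matrix (Fin N) (Fin N) ℂ) → PBond P k → Matrix (Fin N) (Fin N) ℂ) (coeField (Γ 0))) (coeField (Γ 0)) :=
    ((contDiffAt_iterM k (smallBelow_of_plaqSmall ht₀ hstδ hsm)).hasStrictFDerivAt (by simp)).hasFDerivAt
  have hcomp := hD.comp_hasDerivAt (0 : ℝ) hΓ
  have hc : Tendsto (fun t => coeField (Γ t)) (𝓝 0) (𝓝 (coeField (Γ 0))) := hΓ.continuousAt.tendsto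
  exact hcomp.congr_of_eventuallyEq (eventually_coeField_iter_eq_iterM ht₀ hstδ hc hsm)

/-- ★★ **TANGENT-CRITICAL ⇒ CURVE-CRITICAL AT THE ONE-SCALE PIN.**  On a torus `P`, let `U` have `t₀`-small iterated averages `Ū^i`, `i < k` (`stokesConst·t₀ < δ_N`), and suppose
`d∕dt A(U·exp(tX))∣₀ = 0` for every kernel direction `X : bonds → 𝔰𝔲(N)` of the linearised `k`-fold averaging (velocity form).  Then `U` is a critical configuration of (5) on
`𝔅_k(Ū^k(U))` in the CURVE form: along every curve `γ` through `U`, differentiable at `0` as bond matrices and with `Ū^k(γ t) = Ū^k(U)` near `0`, the derivative of `A`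
vanishes.  Proof: the velocity of `γ` is `U·X` with `X ∈ 𝔰𝔲(N)` (§1); `X` is a kernel direction (the derivative of 35b-i's `iterM k` at `↑U` kills the velocity of a fibre
curve, and the ray has the same velocity); tangent-criticality and 35a's same-velocity lemma.
[cite: Balaban1985Variational, (3),(5) p.278, (82)–(83) p.290, (141) p.299, p.300; Balaban1987RG1, (0.4), (0.21) pp.253–256] -/
theorem curveCritical_of_tangentCritical {t₀ : ℝ} (ht₀ : 0 < t₀) (hstδ : stokesConst P * t₀ < deltaSU (Fin N)) {k : ℕ} {U : GaugeField P 0 (SU N)}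
    (hsm : ∀ i, i < k → PlaqSmall t₀ (Averaging.iter (fun i => blockAvg (P := P) (j := i) (expMeanLogSU (n := Fin N))) i U))
    (htan : ∀ X : PBond P 0 → lieSU (Fin N),
      (∀ c : PBond P k, HasDerivAt (fun t : ℝ => ((Averaging.iter (fun i => blockAvg (P := P) (j := i) (expMeanLogSU (n := Fin N))) k
        (expChart U (t • X)) c : SU N) : Matrix (Fin N) (Fin N) ℂ)) 0 0) →
      HasDerivAt (fun t : ℝ => wilsonAction4 (expChart U (t • X))) 0 0)
    (γ : ℝ → GaugeField P 0 (SU N)) (hγ0 : γ 0 = U)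
    (hd : DifferentiableAt ℝ (fun (t : ℝ) (b : PBond P 0) => ((γ t b : SU N) : Matrix (Fin N) (Fin N) ℂ)) 0)
    (hfib : ∀ᶠ t in 𝓝 (0 : ℝ), Averaging.iter (fun i => blockAvg (P := P) (j := i) (expMeanLogSU (n := Fin N))) k (γ t) =
      Averaging.iter (fun i => blockAvg (P := P) (j := i) (expMeanLogSU (n := Fin N))) k U)
    {a : ℝ} (ha : HasDerivAt (fun t => wilsonAction4 (γ t)) a 0) : a = 0 := by
  subst hγ0
  -- bond-wise velocities `Y` of `γ` and the Lie-algebra field `X = U⋆·Y`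
  have hdY : HasDerivAt (fun t => coeField (γ t)) (deriv (fun t => coeField (γ t)) 0) 0 := hd.hasDerivAt
  set Y : PBond P 0 → Matrix (Fin N) (Fin N) ℂ := deriv (fun t => coeField (γ t)) 0 with hYdef
  have hY : ∀ b, HasDerivAt (fun t => ((γ t b : SU N) : Matrix (Fin N) (Fin N) ℂ)) (Y b) 0 := fun b => (hasDerivAt_pi.1 hdY) b
  set X : PBond P 0 → lieSU (Fin N) := fun b =>
    ⟨star ((γ 0 b : SU N) : Matrix (Fin N) (Fin N) ℂ) * Y b, star_mul_deriv_mem_lieSU (γ := fun t => γ t b) (hY b)⟩ with hXdef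
  have hUX : ∀ b, ((γ 0 b : SU N) : Matrix (Fin N) (Fin N) ℂ) * ((X b : lieSU (Fin N)) : Matrix (Fin N) (Fin N) ℂ) = Y b :=
    fun b => coe_mul_star_mul_eq (γ 0 b) (Y b)
  -- the ray has bond-wise velocity `U·X = Y`
  have hray : ∀ b, HasDerivAt (fun t : ℝ => ((expChart (γ 0) (t • X) b : SU N) : Matrix (Fin N) (Fin N) ℂ)) (Y b) 0 := fun b => by
    rw [← hUX b]
    exact hasDerivAt_coe_expChart_along (U := γ 0) (c := fun t : ℝ => t • X) (hasDerivAt_ray X) (zero_smul ℝ X) b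
  have hrayPi : HasDerivAt (fun t : ℝ => coeField (expChart (γ 0) (t • X))) Y 0 := hasDerivAt_pi.2 hray
  -- `X` is a kernel direction: the derivative of `Ū^k` along `γ` is `D Y` and vanishes (constant), and along the ray it is `D Y` too
  set D := fderiv ℝ (iterM k : (PBond P 0 → Matrix (Fin N) (Fin N) ℂ) → PBond P k → Matrix (Fin N) (Fin N) ℂ) (coeField (γ 0)) with hDdef
  have hγD : HasDerivAt (fun t => coeField (Averaging.iter (fun i => blockAvg (P := P) (j := i) (expMeanLogSU (n := Fin N))) k (γ t))) (D Y) 0 :=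
    hasDerivAt_coeField_iter ht₀ hstδ hdY hsm
  have hγ0' : HasDerivAt (fun t => coeField (Averaging.iter (fun i => blockAvg (P := P) (j := i) (expMeanLogSU (n := Fin N))) k (γ t))) 0 0 := by
    refine (hasDerivAt_const (0 : ℝ) (coeField (Averaging.iter (fun i => blockAvg (P := P) (j := i) (expMeanLogSU (n := Fin N))) k (γ 0)))).congr_of_eventuallyEq ?_
    exact hfib.mono fun t ht => by
      show coeField (Averaging.iter _ k (γ t)) = coeField (Averaging.iter _ k (γ 0))
      rw [ht]
  have hDY : D Y = 0 := hγD.unique hγ0'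
  have hray0 : (fun t : ℝ => expChart (γ 0) (t • X)) 0 = γ 0 := by
    show expChart (γ 0) ((0 : ℝ) • X) = γ 0
    rw [zero_smul, expChart_zero]
  have hrayD : HasDerivAt (fun t : ℝ => coeField (Averaging.iter (fun i => blockAvg (P := P) (j := i) (expMeanLogSU (n := Fin N))) k
      (expChart (γ 0) (t • X)))) (D Y) 0 := by
    have h := hasDerivAt_coeField_iter (Γ := fun t : ℝ => expChart (γ 0) (t • X)) ht₀ hstδ hrayPi (k := k)
      (by intro i hi; simp only [zero_smul, expChart_zero]; exact hsm i hi)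
    simp only [zero_smul, expChart_zero] at h
    exact h
  rw [hDY] at hrayD
  have hX : ∀ c : PBond P k, HasDerivAt (fun t : ℝ => ((Averaging.iter (fun i => blockAvg (P := P) (j := i) (expMeanLogSU (n := Fin N))) k
      (expChart (γ 0) (t • X)) c : SU N) : Matrix (Fin N) (Fin N) ℂ)) 0 0 := fun c => by
    have h := (hasDerivAt_pi.1 hrayD) c
    exact h
  -- tangent-criticality along the ray, transferred to `γ` (same base point, same velocities)
  have hA := htan X hX
  have hγA : HasDerivAt (fun t => wilsonAction4 (γ t)) 0 0 :=
    hasDerivAt_wilsonAction4_of_sameVelocity (γ₁ := fun t : ℝ => expChart (γ 0) (t • X)) (γ₂ := γ) hray0 hray hY hA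
  exact ha.unique hγA

end Converse

/-! ## §3  At NODE 00's objects: the equivalence of the two readings -/

section Record

variable {F : T4Family} {N : ℕ} [NeZero N]

/-- ★★ **TANGENT-CRITICAL ⇒ `IsCritOfRecord`** (this seat's g2 curve-form pin) at the objects of record, for configurations with `t₀`-small iterated averages.
[cite: Balaban1985Variational, (3),(5) p.278, (82)–(83) p.290, (141) p.299, p.300] -/
theorem isCritOfRecord_of_tangentCritical {K k : ℕ} {t₀ : ℝ} (ht₀ : 0 < t₀) (hstδ : stokesConst (F.P K) * t₀ < deltaSU (Fin N))
    {U : GaugeField (F.P K) 0 (SU N)} (hsm : ∀ i, i < k → PlaqSmall t₀ (avgFamily (avOfRecord F N K) U i))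
    (htan : ∀ X : PBond (F.P K) 0 → lieSU (Fin N),
      (∀ c : PBond (F.P K) k, HasDerivAt
        (fun t : ℝ => ((avgFamily (avOfRecord F N K) (expChart U (t • X)) k c : SU N) : Matrix (Fin N) (Fin N) ℂ)) 0 0) →
      HasDerivAt (fun t : ℝ => wilsonAction4 (expChart U (t • X))) 0 0) :
    IsCritOfRecord F N K k (avgFamily (avOfRecord F N K) U k) U :=
  fun γ hγ0 hd hfib _ ha => curveCritical_of_tangentCritical (P := F.P K) ht₀ hstδ hsm htan γ hγ0 hd hfib ha

/-- ★★★ **THE TWO READINGS COINCIDE AT SMALL FIELDS.**  At NODE 00's objects, at a level `k ≤ m + K`, for a configuration `U` with `t₀`-small iterated averages `Ū^i`, `i < k`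
(`stokesConst·t₀ < |I|⁻¹∕16` and `< δ_N`): `U` is a critical configuration of (5) on `𝔅_k(Ū^k(U))` in the CURVE form (`IsCritOfRecord`, the tree's pin) IF AND ONLY IF
`d∕dt A(U·exp(tX))∣₀ = 0` for every kernel direction `X` of the linearised `k`-fold averaging (print's TANGENT form (82) on (83)).
[cite: Balaban1985Variational, (3),(5) p.278, Sect. C (47) p.285, (82)–(83) p.290, (141) p.299, p.300, Prop. 8 p.304; Balaban1987RG1, (0.4), (0.11) p.253] -/
theorem isCritOfRecord_iff_tangentCritical {K k : ℕ} (hk : k ≤ (F.P K).m + (F.P K).K) {t₀ : ℝ} (ht₀ : 0 < t₀)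
    (hst : stokesConst (F.P K) * t₀ < emlWeight (F.P K) / 16) (hstδ : stokesConst (F.P K) * t₀ < deltaSU (Fin N))
    {U : GaugeField (F.P K) 0 (SU N)} (hsm : ∀ i, i < k → PlaqSmall t₀ (avgFamily (avOfRecord F N K) U i)) :
    IsCritOfRecord F N K k (avgFamily (avOfRecord F N K) U k) U ↔
      ∀ X : PBond (F.P K) 0 → lieSU (Fin N),
        (∀ c : PBond (F.P K) k, HasDerivAt
          (fun t : ℝ => ((avgFamily (avOfRecord F N K) (expChart U (t • X)) k c : SU N) : Matrix (Fin N) (Fin N) ℂ)) 0 0) →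
        HasDerivAt (fun t : ℝ => wilsonAction4 (expChart U (t • X))) 0 0 :=
  ⟨fun h _ hX => hasDerivAt_wilsonAction4_expChart_of_isCritOfRecord_of_small hk ht₀ hst hstδ hsm h hX,
    isCritOfRecord_of_tangentCritical ht₀ hstδ hsm⟩

/-- ★★★ **AT THE CRIT-PINNED RESIDUAL LAYER `ζ.pinCrit`** (g2; the N07 closers of `BalabanUVNodesN07AtRecordCritPinned`): for a member index `i`, a configuration `U` with
`t₀`-small iterated averages below `i.k` and the datum `V = Ū^{i.k}(U)`, the pinned criticality slot `ζ.pinCrit.IsCrit i V U` (curve form) is EQUIVALENT to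
tangent-criticality in every kernel direction. [cite: Balaban1985Variational, (3),(5) p.278, Props 7–8 pp.299–304, (82)–(83) p.290, (141) p.299] -/
theorem pinCrit_isCrit_iff_tangentCritical (ζ : ResidZ F N) (i : ZIdx) {t₀ : ℝ} (ht₀ : 0 < t₀)
    (hst : stokesConst (F.P i.K) * t₀ < emlWeight (F.P i.K) / 16) (hstδ : stokesConst (F.P i.K) * t₀ < deltaSU (Fin N))
    {U : GaugeField (F.P i.K) 0 (SU N)} (hsm : ∀ i', i' < i.k → PlaqSmall t₀ (avgFamily (avOfRecord F N i.K) U i')) :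
    ζ.pinCrit.IsCrit i (avgFamily (avOfRecord F N i.K) U i.k) U ↔
      ∀ X : PBond (F.P i.K) 0 → lieSU (Fin N),
        (∀ c : PBond (F.P i.K) i.k, HasDerivAt
          (fun t : ℝ => ((avgFamily (avOfRecord F N i.K) (expChart U (t • X)) i.k c : SU N) : Matrix (Fin N) (Fin N) ℂ)) 0 0) →
        HasDerivAt (fun t : ℝ => wilsonAction4 (expChart U (t • X))) 0 0 := by
  have hk : i.k ≤ (F.P i.K).m + (F.P i.K).K := by
    rw [T4Family.P_K]
    exact i.hk.trans (Nat.le_add_left _ _)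
  exact isCritOfRecord_iff_tangentCritical hk ht₀ hst hstδ hsm

end Record

end Summit.QuantumFields.YangMills.BalabanUVNodes.N07CritTangentConverse

end
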